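import Literature.MathematicalPhysics.QuantumFieldTheory.Balaban1983to89.B9CoordSliceMajorant
import Literature.MathematicalPhysics.QuantumFieldTheory.Balaban1983to89.B9Eq3132NuReading

/-!
# `Balaban1983to89.B9Eq3132Ineq2142Covariant` — T. Bałaban, *Propagators for lattice gauge theories in a background field*, Commun. Math. Phys. **99** (1985)
# 389–434 [Balaban1985BackgroundPropagators], (3.132) p. 422 «can be analyzed in the same way as the operator (Q′G′²Q′*)⁻¹» read through [4] p. 248
# «From (2.136) we have (2.142)»: THE ENTRY BOUND (2.142) AT A GENERAL CONFIGURATION `U` — ONE [4]-(2.51) block majorant of the κ-fold coordinate model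
# of a bond-sector letter `T(U)` bounds every block entry of `Q_U T(U) Q*_U`; and the Λ-normalisation bookkeeping ((2.81), (2.149), Lemma 2.1 (2.60))

[4] = T. Bałaban, *Propagators and renormalization transformations for lattice gauge theories. II*, Commun. Math. Phys. **96** (1984) 223–250
[`Balaban1984PropagatorsII`]; [3] = part I, Commun. Math. Phys. **95** (1984) 17–40 [`Balaban1984PropagatorsI`].

statement-level skeleton of published theorems with citation tags; proofs where landed; nothing here is a claim about the Yang–Mills mass gap

THE PRINT.  [B9] p. 422: *«The operators (QG̃Q*)⁻¹, or (QG₁Q*)⁻¹, can be analyzed in the same way as the operator (Q′G′²Q′*)⁻¹. We will not repeat these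
considerations here, let us write only bounds. We have |(QG̃Q*)⁻¹(y, y′)| ≤ O(1)(Lʲη)⁻²(L^{j′}η)^{−d}e^{−δ₁d(y,y′)} … (3.132)»*; [4] p. 248: *«From (2.136) we have
|(QGQ*)(b, b′)| ≤ O(1)(Lʲη)²(L^{j′}η)^{−d}e^{−δ₃d(b,b′)}, b ∈ Λ_j, b′ ∈ Λ_{j′}. (2.142)»*, *«… with ⟨A, J⟩ replaced by ⟨A, Q*B⟩ = ⟨QA, B⟩»*;
[3] (1.18) p. 20: *«(Q_kA)_b = Σ_{x∈B^k(b₋)} η^{d+1} A([x, x(b)])»*; [B9] (3.12)–(3.13) p. 393 (the covariant averaging `Q(U)` and its adjoint, with the transporters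
`U(Γ)`); [4] (2.51)–(2.52) p. 232 (block majorants), (2.81) p. 237 and (2.149) p. 249 (the conjugation `Λ⁻¹(QGQ*)Λ⁻¹`, `Λ_b² = (Lʲη)²L^{−jD}`), Lemma 2.1 (2.60) p. 234.

WHY THIS FILE (dag-n06-i gen 12, N06 bundle F4, row 26).  The N06 certificate of record (`…N06AtOpsYNuOfRecordV6EPair(M)`) displays ROW 26 through four
Combes–Thomas binders on the Λ-normalised real matrices of `(QG_DQ*)(U)`, `(QG₁Q*)(U)` (`B9Eq3132NuReading.s3132Nu_opsYNuOfRecordV4E`: `hco26 hdec26 hco₁26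
hdec₁26`).  The two DECAY binders are (2.142) at `U` for the genuine Sect.-D letters, and ROW 20 of the same certificate already displays what proves it: Theorem 3.3
for `G₀` + the (3.131)∕(3.137) steps at the coordinate pins give the (2.51) block majorant of `GcoK … G_D(U)` ∕ `… G₁(U)` (n06-l `B9Thm312WholeLeaf.entry0_of_step`).
THIS FILE is the one-configuration half: (2.142) at `U` from ONE such majorant (r03's `B6Ineq2142KLevelV1` = the `U = 1` case: the weights `qwt`, their support,
`metBlocks`, `geomT_dist_ends_le` — consumed BY NAME), with [B9]'s transporters (contractive) and the 𝔸-valued test function `Q*_U(δ_{y′} ⊗ E)` carried by ONE slice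
of the κ-fold model (n06-i g11 `B9CoordSliceMajorant.mul_norm_apply_le_of_hasMajorantHom`); and the powers of `Lʲη` of the Λ-normalisation.  The family statement
(`DecayUnder`) and the record corollaries are the sequel `B9Eq3132DecayFromMajorant`.

WHAT IS PROVED (sorry-free; finite-dimensional linear algebra, lattice bookkeeping, real arithmetic; no estimate of the paper is asserted).
* §1 `qK_apply` (def-Y's flat kernel `qK` IS r03's weight `qwt`), `sum_qwt_eq_one`, `QsY_deltaY_apply ∕ _eq_zero`, `norm_QsY_deltaY_le` (`≤ L^{−j′D}‖E‖`), `norm_QY_apply_le`.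
* §2 under a LEVEL-FAITHFUL (`hlev`) and 1-FAITHFUL (`hβ1`) block map `bI` (n06-k's binders of the certificate): `two_le_RMh`, `ends_of_qwt_ne_zero`, `blkV1_mem_metBlocks`,
  `lvl_bI_le_of_qwt_ne_zero`, `len_bI_le_of_qwt_ne_zero`, ★ `dist_bI_le_of_qwt_ne_zero` (`d(bI f, y) ≤ ℓ + 4` on the contour bonds of `y`), `card_image_support_le`
  (the blocks met by the support of `q_y` number `≤ mN` under `#nbr(·, ℓ+4) ≤ mN`).
* §3 ★★ `norm_QGQOfY_deltaY_le`: `‖(Q_U T(U) Q*_U)(δ_{y′} ⊗ E)(y)‖ ≤ mN·C·e^{2δ(ℓ+4)}·(Lʲη)(y)²·L^{−j(y′)D}·e^{−δd(y,y′)}·‖E‖` from `HasMajorant (blkBK bI) (GcoK … T U)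
  (C(Lʲη)²e^{−δd})` — (2.142) at `U`.
* §4 `reMatY_apply`, `normMatY_apply`, ★ `abs_normMatY_le` (the normalised entry through the block entry in norm).
* §5 `len_eq_pow`, `lamY_sq_eq` (`Λ_y² = (Lʲη)²L^{−jD}`), `levelFactor_sq`, ★ `levelFactor_le` (`Λ_y⁻¹Λ_{y′}⁻¹(Lʲη)(y)²L^{−j(y′)D} ≤ L^{(d+3)∕2}e^{(ε∕2)d}` above the (2.60)
  threshold `(d+3)log L ≤ ε(2L²−1)M`, n06-i g2 `transferL_geo9K`).

HONEST SCOPE.  Bookkeeping over landed objects; the block majorant is a HYPOTHESIS here (supplied in the sequel from row 20's displayed inputs); nothing of [B9],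
[3] or [4] is asserted; count-neutral; N06 NOT discharged; one finite 𝕋^{d+1} programme at fixed ε — nothing continuum, nothing OS, nothing about the mass gap.
Cell `pub-ymgap` (HUMAN RULING D-0062), Track A node N06 [B9], seat `pub-ymgap-dag-n06-i` (gen 12), 2026-08-27; a NEW file, nothing landed is modified.
-/

noncomputable section

namespace Literature.MathematicalPhysics.QuantumFieldTheory.Balaban1983to89.B9Eq3132Ineq2142Covariant

open B6RandomWalk (HasMajorant BlockSupp blockPiece sum_blockPiece blockSupp_blockPiece)
open B6RandomWalkHom (HasMajorantHom hasMajorantHom_iff)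
open B9CoReadingCoords (coordOpK XBK blkBK GcoK)
open B9Thm39ReadingCoords (cR39 cR39_nonneg)
open B9CoordSliceMajorant (mul_norm_apply_le_of_hasMajorantHom)
open B6Ineq2133TwoScaleV1 (onFun onFun_apply)
open B6SectAOperatorsV1 (QE BondIdx)
open B6Ineq2142KLevelV1 (lvl β qwt qwt_le qwt_nonneg exists_of_qwt_ne_zero metBlocks mem_metBlocks card_metBlocks_le
  geomT_dist_ends_le lev_ends_bounds iterBlockOf_runSite_mem lvl_le_mK abs_QE_apply_le)
open B9Eq39Adjoint (R R_def)

variable {𝔸 : Type} [NormedRing 𝔸] [NormedAlgebra ℂ 𝔸]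

/-! ## §1 The test function `Q*_U(δ_{y′} ⊗ E)` and the outer average `Q_U`: weights, support, size -/

section TestFunction

open Node00 (IBondY FBondY CfgY BondParY deltaY QY QsY qK qsK qT qsK_eq_transpose trLiftY_apply)
open B6KLevelCensusIndexV1 (KIdx)

variable {d ℓ : ℕ} {hd : 1 ≤ d + 1} {hL : Odd (ℓ + 1) ∧ 1 < ℓ + 1} {b₀ b₁ : ℝ}
variable [CompleteSpace 𝔸] (i : KIdx d ℓ hd hL b₀ b₁) (parB : BondParY 𝔸 i) (U : CfgY 𝔸 i)

/-- the flat kernel of `Q` IS r03's averaging weight: `qK y f = q_y(f)` ([4] (1.18)). [cite: Balaban1984PropagatorsI, (1.18) p.20; Balaban1984PropagatorsII, (2.20) p.226, bookkeeping] -/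
theorem qK_apply (y : IBondY i) (f : FBondY i) : qK i y f = qwt i.hN i.D i.hk y f := by
  rw [qK, LinearMap.toMatrix'_apply, onFun_apply]
  rfl

/-- **THE WEIGHTS OF ONE COARSE BOND HAVE TOTAL MASS ONE**: `Σ_f q_y(f) = 1` (`Q` reproduces constants). [cite: Balaban1984PropagatorsI, (1.18) p.20, (1.15) p.19] -/
theorem sum_qwt_eq_one (y : IBondY i) : ∑ f : FBondY i, qwt i.hN i.D i.hk y f = 1 := by
  classical
  have hlin : ∑ f : FBondY i, qwt i.hN i.D i.hk y f =
      QE (B6GlobalChartV1.domT i.hN i.D i.hk) (WithLp.toLp 2 (fun _ : FBondY i => (1 : ℝ))) y := by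
    unfold qwt
    have hs : (∑ c : FBondY i, EuclideanSpace.single c (1 : ℝ)) = WithLp.toLp 2 (fun _ : FBondY i => (1 : ℝ)) := by
      ext f
      rw [WithLp.ofLp_sum, Finset.sum_apply, Finset.sum_eq_single f]
      · simp
      · intro c _ hc; simp [Ne.symm hc]
      · intro h; exact absurd (Finset.mem_univ _) h
    rw [← hs, map_sum, WithLp.ofLp_sum, Finset.sum_apply]
  rw [hlin, B6Ineq2142KLevelV1.QE_apply_eq_sum]
  simp only [Finset.sum_const, Finset.card_range, nsmul_eq_mul, mul_one]
  rw [B5Eq118OneStroke.card_iterBlock _ (lvl_le_mK i.hN i.D i.hk y)]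
  have h := B6Ineq2142KLevelV1.cQ_mul_card (d := d) (ℓ := ℓ) (lvl i.hN i.D i.hk y)
  push_cast at h ⊢
  linear_combination h

/-- `Q*_U(δ_{y′} ⊗ E)`, evaluated: `q_{y′}(f) • R(τ(y′, f)⁻¹)E` ((3.13): `Q*` transports the coarse value back to the fine bond).
[cite: Balaban1985BackgroundPropagators, (3.13) p.393; Balaban1984PropagatorsII, (2.18) p.226] -/
theorem QsY_deltaY_apply (y' : IBondY i) (E : 𝔸) (f : FBondY i) :
    QsY i parB U (deltaY y' E) f = ((qwt i.hN i.D i.hk y' f : ℝ) : ℂ) • R (qT i parB U y' f)⁻¹ E := by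
  rw [QsY, trLiftY_apply, Finset.sum_eq_single y']
  · rw [qsK_eq_transpose, Matrix.transpose_apply, qK_apply]
    simp [deltaY]
  · intro ι _ hι
    simp [deltaY, hι]
  · intro h; exact absurd (Finset.mem_univ _) h

/-- `Q*_U(δ_{y′} ⊗ E)` vanishes off the support of the weight `q_{y′}` (the double block of `y′`). [cite: Balaban1984PropagatorsI, (1.18) p.20, bookkeeping] -/
theorem QsY_deltaY_eq_zero {y' : IBondY i} (E : 𝔸) {f : FBondY i} (hf : qwt i.hN i.D i.hk y' f = 0) :
    QsY i parB U (deltaY y' E) f = 0 := by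
  rw [QsY_deltaY_apply, hf]; simp

/-- `‖Q*_U(δ_{y′} ⊗ E)(f)‖ ≤ L^{−j′D}·‖E‖` for CONTRACTIVE transporters (`‖τ‖, ‖τ⁻¹‖ ≤ 1` — unitary matrices in print): the weight bound `q ≤ L^{−jD}`.
[cite: Balaban1984PropagatorsI, (1.18) p.20; Balaban1985BackgroundPropagators, (3.13) p.393, bookkeeping] -/
theorem norm_QsY_deltaY_le (hpar : ∀ s s', ‖(parB U s s' : 𝔸)‖ ≤ 1 ∧ ‖(((parB U s s')⁻¹ : 𝔸ˣ) : 𝔸)‖ ≤ 1)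
    (y' : IBondY i) (E : 𝔸) (f : FBondY i) :
    ‖QsY i parB U (deltaY y' E) f‖ ≤ ((((ℓ + 1 : ℕ) : ℝ) ^ (d + 1)) ^ (lvl i.hN i.D i.hk y'))⁻¹ * ‖E‖ := by
  rw [QsY_deltaY_apply, norm_smul, Complex.norm_real, Real.norm_eq_abs, abs_of_nonneg (qwt_nonneg _ _ _ _ _)]
  refine mul_le_mul (qwt_le _ _ _ _ _) ?_ (norm_nonneg _) (by positivity)
  rw [R_def, inv_inv]
  obtain ⟨h1, h2⟩ : ‖(qT i parB U y' f : 𝔸)‖ ≤ 1 ∧ ‖(((qT i parB U y' f)⁻¹ : 𝔸ˣ) : 𝔸)‖ ≤ 1 := hpar _ _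
  calc ‖(((qT i parB U y' f)⁻¹ : 𝔸ˣ) : 𝔸) * E * (qT i parB U y' f : 𝔸)‖
      ≤ ‖(((qT i parB U y' f)⁻¹ : 𝔸ˣ) : 𝔸)‖ * ‖E‖ * ‖(qT i parB U y' f : 𝔸)‖ :=
        (norm_mul_le _ _).trans (mul_le_mul_of_nonneg_right (norm_mul_le _ _) (norm_nonneg _))
    _ ≤ 1 * ‖E‖ * 1 := by
        refine mul_le_mul (mul_le_mul_of_nonneg_right h2 (norm_nonneg _)) h1 (norm_nonneg _) (by positivity)
    _ = ‖E‖ := by ring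

/-- **THE OUTER AVERAGE DOES NOT INCREASE NORMS**: `‖(Q_U v)(y)‖ ≤ S` whenever `‖v(f)‖ ≤ S` on the contour bonds of `y` (weights `q_y ≥ 0` of total mass 1,
contractive transporters). [cite: Balaban1984PropagatorsI, (1.18) p.20; Balaban1985BackgroundPropagators, (3.12) p.393] -/
theorem norm_QY_apply_le (hpar : ∀ s s', ‖(parB U s s' : 𝔸)‖ ≤ 1 ∧ ‖(((parB U s s')⁻¹ : 𝔸ˣ) : 𝔸)‖ ≤ 1)
    (v : FBondY i → 𝔸) (y : IBondY i) {S : ℝ} (hS : ∀ f : FBondY i, qwt i.hN i.D i.hk y f ≠ 0 → ‖v f‖ ≤ S) :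
    ‖QY i parB U v y‖ ≤ S := by
  rw [QY, trLiftY_apply]
  have hterm : ∀ f : FBondY i, ‖((qK i y f : ℝ) : ℂ) • R (qT i parB U y f) (v f)‖ ≤ qwt i.hN i.D i.hk y f * ‖v f‖ := by
    intro f
    rw [qK_apply, norm_smul, Complex.norm_real, Real.norm_eq_abs, abs_of_nonneg (qwt_nonneg _ _ _ _ _)]
    refine mul_le_mul_of_nonneg_left ?_ (qwt_nonneg _ _ _ _ _)
    rw [R_def]
    obtain ⟨h1, h2⟩ : ‖(qT i parB U y f : 𝔸)‖ ≤ 1 ∧ ‖(((qT i parB U y f)⁻¹ : 𝔸ˣ) : 𝔸)‖ ≤ 1 := hpar _ _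
    calc ‖(qT i parB U y f : 𝔸) * v f * (((qT i parB U y f)⁻¹ : 𝔸ˣ) : 𝔸)‖
        ≤ ‖(qT i parB U y f : 𝔸)‖ * ‖v f‖ * ‖(((qT i parB U y f)⁻¹ : 𝔸ˣ) : 𝔸)‖ :=
          (norm_mul_le _ _).trans (mul_le_mul_of_nonneg_right (norm_mul_le _ _) (norm_nonneg _))
      _ ≤ 1 * ‖v f‖ * 1 := mul_le_mul (mul_le_mul_of_nonneg_right h1 (norm_nonneg _)) h2 (norm_nonneg _) (by positivity)
      _ = ‖v f‖ := by ring
  have hterm' : ∀ f : FBondY i, qwt i.hN i.D i.hk y f * ‖v f‖ ≤ qwt i.hN i.D i.hk y f * S := by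
    intro f
    by_cases h : qwt i.hN i.D i.hk y f = 0
    · rw [h, zero_mul, zero_mul]
    · exact mul_le_mul_of_nonneg_left (hS f h) (qwt_nonneg _ _ _ _ _)
  calc ‖∑ f, ((qK i y f : ℝ) : ℂ) • R (qT i parB U y f) (v f)‖
      ≤ ∑ f, ‖((qK i y f : ℝ) : ℂ) • R (qT i parB U y f) (v f)‖ := norm_sum_le _ _
    _ ≤ ∑ f, qwt i.hN i.D i.hk y f * S := Finset.sum_le_sum fun f _ => (hterm f).trans (hterm' f)
    _ = S := by rw [← Finset.sum_mul, sum_qwt_eq_one, one_mul]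

end TestFunction

/-! ## §2 The contour bonds of an index bond under a LEVEL-∕1-FAITHFUL block map: levels, lengths, distances, the count -/

section Geometry

open Node00 (IBondY FBondY toKT)
open B6KLevelCensusIndexV1 (KIdx)
open B6GlobalChartV1 (blkV1 toBox)
open B6Geom246MultiLevelBox (blkOf)
open B9GeoNormsKLevelV1 (geo9K)
open B9GeoLemma21KLevelV1 (one_le_Mh one_le_P one_le_k geo9K_len_pos)
open B9Ineq349SiteComposite (distB distB_nonneg)
open B9Ineq349SiteFromBlocks (distB_triangle)
open B6Ineq288MultiLevelTorus (dist_symm_geoBT)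
open B9RWSumsReadsNbr (nbr mem_nbr)
open LatticeFieldCalculus (runBond runSite)
open B5Eq118OneStroke (iterBlockOf mem_iterBlock)

variable {d ℓ : ℕ} {hd : 1 ≤ d + 1} {hL : Odd (ℓ + 1) ∧ 1 < ℓ + 1} {b₀ b₁ : ℝ}
variable (i : KIdx d ℓ hd hL b₀ b₁) {bI : FBondY i → IBondY i}

/-- `R·M_h ≥ 2` for every index (`R ≥ 2L²`, `M_h ≥ 8`). [cite: Balaban1984PropagatorsII, (2.1)–(2.2) p.224, bookkeeping] -/
theorem two_le_RMh : 2 ≤ i.R * i.Mh := by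
  have hR : 1 ≤ i.R := le_trans (by nlinarith [Nat.zero_le ℓ]) i.hR2
  have hM : 2 ≤ i.Mh := le_trans (by norm_num) i.hM8
  calc 2 = 1 * 2 := by norm_num
    _ ≤ i.R * i.Mh := Nat.mul_le_mul hR hM

/-- **A CONTOUR BOND OF `y` STARTS IN THE DOUBLE BLOCK OF `y`** (support of the weight `q_y`, [4] (1.18): `x ∈ B^j(y₋)`, `t < L^j`).
[cite: Balaban1984PropagatorsI, (1.18) p.20 («x(b) is a point in B^k(b₊)»)] -/
theorem ends_of_qwt_ne_zero {y : IBondY i} {f : FBondY i} (hf : qwt i.hN i.D i.hk y f ≠ 0) :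
    iterBlockOf (lvl i.hN i.D i.hk y) f.src = y.1.2.src ∨ iterBlockOf (lvl i.hN i.D i.hk y) f.src = y.1.2.tgt := by
  obtain ⟨x', hx', t', ht', rfl⟩ := exists_of_qwt_ne_zero i.hN i.D i.hk y hf
  rw [mem_iterBlock] at hx'
  change iterBlockOf _ (runSite x' y.1.2.dir t') = _ ∨ iterBlockOf _ (runSite x' y.1.2.dir t') = _
  rcases iterBlockOf_runSite_mem (lvl_le_mK i.hN i.D i.hk y) x' y.1.2.dir ht'.le with h | h
  · exact Or.inl (h.trans hx')
  · right; rw [h, hx']; rfl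

/-- the block of a contour bond of `y` lies among the blocks met by the double block of `y`. [cite: Balaban1984PropagatorsII, (2.45) p.231, bookkeeping] -/
theorem blkV1_mem_metBlocks {y : IBondY i} {f : FBondY i} (hf : qwt i.hN i.D i.hk y f ≠ 0) :
    blkV1 i.hN i.D f ∈ metBlocks i.hN i.D i.hk y :=
  mem_metBlocks i.hN i.D i.hk y (ends_of_qwt_ne_zero i hf)

/-- **A LEVEL-FAITHFUL BLOCK MAP DOES NOT RAISE THE LEVEL ALONG A CONTOUR**: `j(bI f) ≤ j(y)` for the contour bonds `f` of `y` (the double block has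
level `j` or `j − 1`). [cite: Balaban1984PropagatorsII, (2.2)–(2.4) p.224] -/
theorem lvl_bI_le_of_qwt_ne_zero (hlev : ∀ f : FBondY i, lvl i.hN i.D i.hk (bI f) = (blkV1 i.hN i.D f).1.1)
    {y : IBondY i} {f : FBondY i} (hf : qwt i.hN i.D i.hk y f ≠ 0) : lvl i.hN i.D i.hk (bI f) ≤ lvl i.hN i.D i.hk y := by
  rw [hlev f]
  exact (lev_ends_bounds i.hN i.D i.hk (one_le_k i) (two_le_RMh i) y (ends_of_qwt_ne_zero i hf)).2

/-- hence `(Lʲη)(bI f) ≤ (Lʲη)(y)`. [cite: Balaban1985BackgroundPropagators, (3.41) p.397, bookkeeping] -/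
theorem len_bI_le_of_qwt_ne_zero (hlev : ∀ f : FBondY i, lvl i.hN i.D i.hk (bI f) = (blkV1 i.hN i.D f).1.1)
    {y : IBondY i} {f : FBondY i} (hf : qwt i.hN i.D i.hk y f ≠ 0) : (geo9K i).len (bI f) ≤ (geo9K i).len y := by
  rw [B9GeoNormsKLevelV1.geo9K_len_kGeo, B9GeoNormsKLevelV1.geo9K_len_kGeo, B6KLevelCensusIndexV1.len_eq, B6KLevelCensusIndexV1.len_eq]
  refine div_le_div_of_nonneg_right ?_ (abs_nonneg _)
  exact pow_le_pow_right₀ (by exact_mod_cast Nat.succ_le_succ (Nat.zero_le ℓ)) (lvl_bI_le_of_qwt_ne_zero i hlev hf)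

/-- **A 1-FAITHFUL BLOCK MAP KEEPS THE CONTOUR BONDS NEAR THEIR INDEX BOND**: `d(bI f, y) ≤ ℓ + 4` (`= L + 3`: the met blocks are within `L + 2` of the
carrier block, `bI` within `1` of the block). [cite: Balaban1984PropagatorsII, (2.45)–(2.46) p.231] -/
theorem dist_bI_le_of_qwt_ne_zero (hβ1 : ∀ f : FBondY i, (B6Geom246MultiLevelTorus.geomT i.D).dist (β i.hN i.D i.hk (bI f)) (blkV1 i.hN i.D f) ≤ 1)
    {y : IBondY i} {f : FBondY i} (hf : qwt i.hN i.D i.hk y f ≠ 0) : (geo9K i).dist (bI f) y ≤ (ℓ : ℝ) + 4 := by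
  have h1 : distB i (β i.hN i.D i.hk (bI f)) (blkV1 i.hN i.D f) ≤ 1 := hβ1 f
  have h2 : distB i (β i.hN i.D i.hk y) (blkV1 i.hN i.D f) ≤ (ℓ : ℝ) + 3 :=
    geomT_dist_ends_le i.hN i.D i.hk (one_le_k i) (two_le_RMh i) (one_le_Mh i) (one_le_P i) y (ends_of_qwt_ne_zero i hf)
  have h2' : distB i (blkV1 i.hN i.D f) (β i.hN i.D i.hk y) ≤ (ℓ : ℝ) + 3 := by
    have hs : distB i (blkV1 i.hN i.D f) (β i.hN i.D i.hk y) = distB i (β i.hN i.D i.hk y) (blkV1 i.hN i.D f) := dist_symm_geoBT (toKT i) _ _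
    rw [hs]; exact h2
  have t := distB_triangle i (β i.hN i.D i.hk (bI f)) (blkV1 i.hN i.D f) (β i.hN i.D i.hk y)
  change distB i (β i.hN i.D i.hk (bI f)) (β i.hN i.D i.hk y) ≤ _
  linarith

open Classical in
/-- **THE IMAGE OF THE SUPPORT OF `q_{y}` UNDER THE BLOCK MAP IS SMALL**: it lies in the radius-`(ℓ+4)` neighbourhood of `y`, so it has at most `mN`
members under the count `#nbr(·, ℓ+4) ≤ mN` ([4] (2.61) ⇒ (2.59)). [cite: Balaban1984PropagatorsII, (2.45) p.231, Lemma 2.1 (2.59)–(2.61) pp.233–234] -/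
theorem card_image_support_le [instF : Fintype (geo9K i).Site]
    (hβ1 : ∀ f : FBondY i, (B6Geom246MultiLevelTorus.geomT i.D).dist (β i.hN i.D i.hk (bI f)) (blkV1 i.hN i.D f) ≤ 1)
    {mN : ℕ} (hnbr : ∀ y : (geo9K i).Site, (nbr (geo9K i) ((ℓ : ℝ) + 4) y).card ≤ mN) (y : IBondY i) :
    ((Finset.univ.filter fun f : FBondY i => qwt i.hN i.D i.hk y f ≠ 0).image bI).card ≤ mN := by
  refine le_trans (Finset.card_le_card ?_) (hnbr y)
  intro c hc
  rw [Finset.mem_image] at hc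
  obtain ⟨f, hf, rfl⟩ := hc
  exact mem_nbr.2 (dist_bI_le_of_qwt_ne_zero i hβ1 (Finset.mem_filter.1 hf).2)

end Geometry

/-! ## §3 ★ (2.142) AT THE CONFIGURATION `U`: ONE block majorant of the coordinate model of `T(U)` bounds the entries of `Q_U T(U) Q*_U` -/

section Ineq2142

open Node00 (IBondY FBondY CfgY BondOpY BondParY deltaY QY QsY QGQOfY toKT)
open B6KLevelCensusIndexV1 (KIdx)
open B6GlobalChartV1 (blkV1)
open B9Thm34Ext (toB6)
open B9GeoNormsKLevelV1 (geo9K)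
open B9GeoLemma21KLevelV1 (geo9K_len_pos geo9K_dist_nonneg')
open B9RWSumsReadsNbr (nbr mem_nbr)

variable {κ : Type} [Fintype κ] [DecidableEq κ]
variable {d ℓ : ℕ} {hd : 1 ≤ d + 1} {hL : Odd (ℓ + 1) ∧ 1 < ℓ + 1} {b₀ b₁ : ℝ}
variable [CompleteSpace 𝔸] [FiniteDimensional ℝ 𝔸]

open Classical in
/-- ★ **(2.142) AT `U` FROM ONE BLOCK MAJORANT** (print [4] p. 248 «From (2.136) we have (2.142)», transported: [B9] p. 422 «The operators (QG̃Q*)⁻¹ …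
can be analyzed in the same way as the operator (Q′G′²Q′*)⁻¹»): at an index `i`, for a bond-sector letter `T`, bond transporters `parB` CONTRACTIVE at
`U`, a block map `bI` LEVEL-FAITHFUL (`hlev`) and 1-FAITHFUL (`hβ1`), the radius-`(ℓ+4)` count `#nbr ≤ mN`, and the [4]-(2.51) block majorant
`C(Lʲη)²e^{−δd}` of the coordinate model `GcoK … T U` (`C, δ ≥ 0`):
`‖(Q_U T(U) Q*_U)(δ_{y′} ⊗ E)(y)‖ ≤ mN·C·e^{2δ(ℓ+4)}·(Lʲη)(y)²·L^{−j(y′)D}·e^{−δd(y,y′)}·‖E‖`.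
[cite: Balaban1984PropagatorsII, (2.142) p.248, (2.51)–(2.52) p.232; Balaban1985BackgroundPropagators, (3.132) p.422] -/
theorem norm_QGQOfY_deltaY_le (i : KIdx d ℓ hd hL b₀ b₁) [instF : Fintype (geo9K i).Site] (b : Module.Basis κ ℝ 𝔸)
    {B : B9.Backgrounds} (cfg : B.Cfg → CfgY 𝔸 i) (T : BondOpY 𝔸 i) (parB : BondParY 𝔸 i) (U₁ : B.Cfg)
    {bI : FBondY i → IBondY i}
    (hlev : ∀ f : FBondY i, lvl i.hN i.D i.hk (bI f) = (blkV1 i.hN i.D f).1.1)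
    (hβ1 : ∀ f : FBondY i, (B6Geom246MultiLevelTorus.geomT i.D).dist (β i.hN i.D i.hk (bI f)) (blkV1 i.hN i.D f) ≤ 1)
    {mN : ℕ} (hnbr : ∀ y : (geo9K i).Site, (nbr (geo9K i) ((ℓ : ℝ) + 4) y).card ≤ mN)
    (hpar : ∀ s s', ‖(parB (cfg U₁) s s' : 𝔸)‖ ≤ 1 ∧ ‖(((parB (cfg U₁) s s')⁻¹ : 𝔸ˣ) : 𝔸)‖ ≤ 1)
    {R : ℝ} {H : Prop} {C δ : ℝ} (hC : 0 ≤ C) (hδ : 0 ≤ δ)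
    (h0 : HasMajorant (g := toB6 (geo9K i) R H) (blkBK i bI) (GcoK i b B cfg T U₁)
      (fun a a' => C * (geo9K i).len a ^ 2 * Real.exp (-(δ * (geo9K i).dist a a'))))
    (y y' : IBondY i) (E : 𝔸) :
    ‖QGQOfY i parB T (cfg U₁) (deltaY y' E) y‖ ≤
      mN * C * Real.exp (2 * (δ * ((ℓ : ℝ) + 4))) * (geo9K i).len y ^ 2 * ((((ℓ + 1 : ℕ) : ℝ) ^ (d + 1)) ^ (lvl i.hN i.D i.hk y'))⁻¹ *
        Real.exp (-(δ * (geo9K i).dist y y')) * ‖E‖ := by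
  -- the test function `λ = Q*_U(δ_{y′} ⊗ E)`: support and size
  set lam : FBondY i → 𝔸 := QsY i parB (cfg U₁) (deltaY y' E) with hlam
  set cl : ℝ := ((((ℓ + 1 : ℕ) : ℝ) ^ (d + 1)) ^ (lvl i.hN i.D i.hk y'))⁻¹ * ‖E‖ with hcl
  have hcl0 : 0 ≤ cl := by rw [hcl]; positivity
  have hsupp : ∀ f : FBondY i, ¬ (qwt i.hN i.D i.hk y' f ≠ 0) → lam f = 0 := fun f hf => by
    rw [hlam]; exact QsY_deltaY_eq_zero i parB (cfg U₁) E (not_not.1 hf)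
  have hbd : ∀ f : FBondY i, ‖lam f‖ ≤ cl := fun f => norm_QsY_deltaY_le i parB (cfg U₁) hpar y' E f
  have hlen0 : ∀ a : (geo9K i).Site, 0 ≤ (geo9K i).len a := fun a => (geo9K_len_pos i a).le
  -- the blocks met by the support of `λ`
  set I : Finset (IBondY i) := (Finset.univ.filter fun f : FBondY i => qwt i.hN i.D i.hk y' f ≠ 0).image bI with hIdef
  have hI : ∀ f : FBondY i, qwt i.hN i.D i.hk y' f ≠ 0 → bI f ∈ I := fun f hf =>
    Finset.mem_image_of_mem _ (Finset.mem_filter.2 ⟨Finset.mem_univ _, hf⟩)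
  have hIcard : (I.card : ℝ) ≤ mN := by exact_mod_cast card_image_support_le i (instF := instF) hβ1 hnbr y'
  have hK : ∀ a a' : (geo9K i).Site, 0 ≤ C * (geo9K i).len a ^ 2 * Real.exp (-(δ * (geo9K i).dist a a')) :=
    fun a a' => mul_nonneg (mul_nonneg hC (pow_nonneg (hlen0 a) 2)) (Real.exp_nonneg _)
  have h0' : HasMajorantHom (g := toB6 (geo9K i) R H) (fun p : XBK κ i => bI p.1) (fun p : XBK κ i => bI p.1)
      ((1 * cR39 b) • coordOpK b (fun _ : Fin (d + 1) => (T (cfg U₁)).restrictScalars ℝ))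
      (fun a a' => C * (geo9K i).len a ^ 2 * Real.exp (-(δ * (geo9K i).dist a a'))) := by
    rw [one_mul]; exact (hasMajorantHom_iff (g := toB6 (geo9K i) R H) _ _ _).2 h0
  -- the key constant
  set S : ℝ := cl * (mN * (C * (geo9K i).len y ^ 2 * Real.exp (2 * (δ * ((ℓ : ℝ) + 4))) * Real.exp (-(δ * (geo9K i).dist y y'))))
    with hSdef
  have hmain : ∀ f : FBondY i, qwt i.hN i.D i.hk y f ≠ 0 → ‖T (cfg U₁) lam f‖ ≤ S := by
    intro f hf
    have step := mul_norm_apply_le_of_hasMajorantHom (g := toB6 (geo9K i) R H) b bI zero_le_one hK h0'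
      (fun f' : FBondY i => qwt i.hN i.D i.hk y' f' ≠ 0) hsupp hcl0 hbd I hI f (0 : Fin (d + 1))
    rw [one_mul, LinearMap.restrictScalars_apply] at step
    refine step.trans ?_
    rw [hSdef]
    refine mul_le_mul_of_nonneg_left ?_ hcl0
    -- each term of the block sum: the length of `bI f` is at most that of `y`, the distance at least `d(y,y′) − 2(ℓ+4)`
    have hdy : (geo9K i).dist (bI f) y ≤ (ℓ : ℝ) + 4 := dist_bI_le_of_qwt_ne_zero i hβ1 hf
    have hterm : ∀ c ∈ I, C * (geo9K i).len (bI f) ^ 2 * Real.exp (-(δ * (geo9K i).dist (bI f) c)) ≤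
        C * (geo9K i).len y ^ 2 * Real.exp (2 * (δ * ((ℓ : ℝ) + 4))) * Real.exp (-(δ * (geo9K i).dist y y')) := by
      intro c hc
      rw [hIdef, Finset.mem_image] at hc
      obtain ⟨f', hf', rfl⟩ := hc
      have hf'' : qwt i.hN i.D i.hk y' f' ≠ 0 := (Finset.mem_filter.1 hf').2
      have hdy' : (geo9K i).dist (bI f') y' ≤ (ℓ : ℝ) + 4 := dist_bI_le_of_qwt_ne_zero i hβ1 hf''
      have hlenle : (geo9K i).len (bI f) ^ 2 ≤ (geo9K i).len y ^ 2 :=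
        pow_le_pow_left₀ (hlen0 _) (len_bI_le_of_qwt_ne_zero i hlev hf) 2
      -- `d(y, y′) ≤ d(y, bI f) + d(bI f, bI f′) + d(bI f′, y′)`
      have htri : (geo9K i).dist y y' ≤ (geo9K i).dist (bI f) y + (geo9K i).dist (bI f) (bI f') + (geo9K i).dist (bI f') y' := by
        have t1 := B9GeoLemma21KLevelV1.geo9K_dist_triangle i y (bI f) y'
        have t2 := B9GeoLemma21KLevelV1.geo9K_dist_triangle i (bI f) (bI f') y'
        rw [B9GeoLemma21KLevelV1.geo9K_dist_comm i y (bI f)] at t1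
        linarith
      have hexp : Real.exp (-(δ * (geo9K i).dist (bI f) (bI f'))) ≤
          Real.exp (2 * (δ * ((ℓ : ℝ) + 4))) * Real.exp (-(δ * (geo9K i).dist y y')) := by
        rw [← Real.exp_add]
        apply Real.exp_le_exp.2
        have := mul_le_mul_of_nonneg_left htri hδ
        nlinarith [mul_le_mul_of_nonneg_left hdy hδ, mul_le_mul_of_nonneg_left hdy' hδ]
      calc C * (geo9K i).len (bI f) ^ 2 * Real.exp (-(δ * (geo9K i).dist (bI f) (bI f')))
          ≤ C * (geo9K i).len y ^ 2 * (Real.exp (2 * (δ * ((ℓ : ℝ) + 4))) * Real.exp (-(δ * (geo9K i).dist y y'))) :=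
            mul_le_mul (mul_le_mul_of_nonneg_left hlenle hC) hexp (Real.exp_nonneg _) (mul_nonneg hC (pow_nonneg (hlen0 _) 2))
        _ = _ := by ring
    have hpos : 0 ≤ C * (geo9K i).len y ^ 2 * Real.exp (2 * (δ * ((ℓ : ℝ) + 4))) * Real.exp (-(δ * (geo9K i).dist y y')) := by
      positivity
    calc ∑ c ∈ I, C * (geo9K i).len (bI f) ^ 2 * Real.exp (-(δ * (geo9K i).dist (bI f) c))
        ≤ I.card • (C * (geo9K i).len y ^ 2 * Real.exp (2 * (δ * ((ℓ : ℝ) + 4))) * Real.exp (-(δ * (geo9K i).dist y y'))) :=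
          Finset.sum_le_card_nsmul _ _ _ hterm
      _ = (I.card : ℝ) * _ := by rw [nsmul_eq_mul]
      _ ≤ mN * _ := mul_le_mul_of_nonneg_right hIcard hpos
  have hS0 : 0 ≤ S := by rw [hSdef]; positivity
  -- the outer average
  have hQ := norm_QY_apply_le i parB (cfg U₁) hpar (T (cfg U₁) lam) y hmain
  calc ‖QGQOfY i parB T (cfg U₁) (deltaY y' E) y‖ = ‖QY i parB (cfg U₁) (T (cfg U₁) lam) y‖ := by rw [hlam]; rfl
    _ ≤ S := hQ
    _ = _ := by rw [hSdef, hcl]; ring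

end Ineq2142

/-! ## §4 The entries of the normalised real matrix `diag(w∕κ′)·reMatY·diag(w)` through the block norms -/

section NormMat

open Node00 (deltaY)
open B9Eq3132RingInverseReading (reMatY normMatY piBasisY piBasisY_apply piBasisY_repr dimConstY' dimConstY'_pos abs_repr_le)

variable {X : Type} [Fintype X] [DecidableEq X] {Ff : Type} [Fintype Ff] [DecidableEq Ff] (b : Module.Basis Ff ℝ 𝔸)

/-- the entries of the real matrix of a letter are the `b`-coordinates of its block entries on the basis directions:
`reMatY b T (x,f) (x′,f′) = repr_f ((T(δ_{x′} ⊗ b_{f′}))(x))`. [cite: Balaban1985BackgroundPropagators, (3.132) p.422, dictionary] -/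
theorem reMatY_apply (T : (X → 𝔸) →ₗ[ℂ] (X → 𝔸)) (a c : X × Ff) : reMatY b T a c = b.repr (T (deltaY c.1 (b c.2)) a.1) a.2 := by
  unfold reMatY
  rw [LinearMap.toMatrix_apply, piBasisY_apply, piBasisY_repr, LinearMap.restrictScalars_apply]

/-- the entries of the normalised matrix. [cite: Balaban1985BackgroundPropagators, (3.132) p.422, bookkeeping] -/
theorem normMatY_apply (w : X → ℝ) (T : Module.End ℂ (X → 𝔸)) (a c : X × Ff) :
    normMatY b w T a c = w a.1 / dimConstY' b * reMatY b T a c * w c.1 := by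
  unfold normMatY
  rw [Matrix.mul_diagonal, Matrix.diagonal_mul]

/-- ★ **THE NORMALISED ENTRY IS DOMINATED BY THE BLOCK ENTRY IN NORM**: `|S (x,f) (x′,f′)| ≤ w(x)·w(x′)·(‖repr‖∕κ′)·‖(T(δ_{x′} ⊗ b_{f′}))(x)‖`
for non-negative weights. [cite: Balaban1985BackgroundPropagators, (3.132) p.422 (dictionary: kernel entry ↔ block of the real matrix)] -/
theorem abs_normMatY_le {w : X → ℝ} (hw : ∀ x, 0 ≤ w x) (T : Module.End ℂ (X → 𝔸)) (a c : X × Ff) :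
    |normMatY b w T a c| ≤ w a.1 * w c.1 * (‖(b.equivFunL : 𝔸 →L[ℝ] (Ff → ℝ))‖ / dimConstY' b) * ‖T (deltaY c.1 (b c.2)) a.1‖ := by
  rw [normMatY_apply, reMatY_apply, abs_mul, abs_mul, abs_of_nonneg (hw c.1), abs_of_nonneg (div_nonneg (hw a.1) (dimConstY'_pos b).le)]
  have h := abs_repr_le b (T (deltaY c.1 (b c.2)) a.1) a.2
  have hκ := dimConstY'_pos b
  calc w a.1 / dimConstY' b * |b.repr (T (deltaY c.1 (b c.2)) a.1) a.2| * w c.1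
      ≤ w a.1 / dimConstY' b * (‖(b.equivFunL : 𝔸 →L[ℝ] (Ff → ℝ))‖ * ‖T (deltaY c.1 (b c.2)) a.1‖) * w c.1 :=
        mul_le_mul_of_nonneg_right (mul_le_mul_of_nonneg_left h (div_nonneg (hw a.1) hκ.le)) (hw c.1)
    _ = _ := by ring

end NormMat

/-! ## §5 The powers of `Lʲη`: `Λ_y⁻¹Λ_{y′}⁻¹·(Lʲη)(y)²·L^{−j(y′)D} = ((Lʲη)(y)∕(Lʲη)(y′))^{1+D∕2}`, absorbed by [4] (2.60) under an M-threshold -/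

section Powers

open Node00 (IBondY)
open B6KLevelCensusIndexV1 (KIdx)
open B9GeoNormsKLevelV1 (geo9K)
open B9GeoLemma21KLevelV1 (geo9K_len_pos geo9K_one_le_L geo9K_dist_comm transferL_geo9K)
open B9Eq3132NuReading (lamY lamInvY lamY_pos lamInvY_pos)
open B6Cor28 (TransferL)

variable {d ℓ : ℕ} {hd : 1 ≤ d + 1} {hL : Odd (ℓ + 1) ∧ 1 < ℓ + 1} {b₀ b₁ : ℝ} (i : KIdx d ℓ hd hL b₀ b₁)

/-- `(Lʲη)(y) = L^{j(y)}·|c_f|⁻¹`. [cite: Balaban1984PropagatorsII, (2.1) p.224; Balaban1985BackgroundPropagators, (3.41) p.397, bookkeeping] -/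
theorem len_eq_pow (y : IBondY i) : (geo9K i).len y = (((ℓ + 1 : ℕ) : ℝ)) ^ (lvl i.hN i.D i.hk y) * |i.cf|⁻¹ := by
  rw [B9GeoNormsKLevelV1.geo9K_len_kGeo, B6KLevelCensusIndexV1.len_eq, div_eq_mul_inv]

/-- **`Λ_y² = (Lʲη)(y)²·L^{−j(y)D}`** ([4] (2.81)∕(2.142): `Λ_i² = (L^{j}∕c_f)²·L^{−jD}`). [cite: Balaban1984PropagatorsII, (2.81) p.237, (2.142) p.248] -/
theorem lamY_sq_eq (y : IBondY i) :
    lamY i y ^ 2 = (geo9K i).len y ^ 2 * ((((ℓ + 1 : ℕ) : ℝ) ^ (d + 1)) ^ (lvl i.hN i.D i.hk y))⁻¹ := by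
  unfold lamY
  rw [B6Prop27KLevelV1.lam_sq i.hN i.D i.hk i.hcf, B6Prop27KLevelV1.wt, len_eq_pow, div_eq_mul_inv, mul_pow, mul_pow, inv_pow, inv_pow, sq_abs]

/-- ★ **THE LEVEL FACTOR OF THE NORMALISATION, SQUARED**: with `P := Λ_y⁻¹Λ_{y′}⁻¹(Lʲη)(y)²L^{−j(y′)D}`,
`P²·(Lʲη)(y′)^{d+3} = (Lʲη)(y)^{d+3}` (`d + 3 = D + 2`). [cite: Balaban1984PropagatorsII, (2.81) p.237, (2.142) p.248, (2.149) p.249, bookkeeping] -/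
theorem levelFactor_sq (y y' : IBondY i) :
    (lamInvY i y * lamInvY i y' * (geo9K i).len y ^ 2 * ((((ℓ + 1 : ℕ) : ℝ) ^ (d + 1)) ^ (lvl i.hN i.D i.hk y'))⁻¹) ^ 2 *
        (geo9K i).len y' ^ (d + 3) = (geo9K i).len y ^ (d + 3) := by
  have hΛ := lamY_pos i y
  have hΛ' := lamY_pos i y'
  have hl := geo9K_len_pos i y
  have hl' := geo9K_len_pos i y'
  have hL0 : (0 : ℝ) < ((ℓ + 1 : ℕ) : ℝ) := by positivity
  have hcf : 0 < |i.cf| := abs_pos.2 i.hcf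
  set j := lvl i.hN i.D i.hk y
  set j' := lvl i.hN i.D i.hk y'
  have e1 := lamY_sq_eq i y
  have e2 := lamY_sq_eq i y'
  have l1 := len_eq_pow i y
  have l2 := len_eq_pow i y'
  unfold lamInvY
  rw [mul_pow, mul_pow, mul_pow, inv_pow, inv_pow, e1, e2, l1, l2]
  have hA : (((ℓ + 1 : ℕ) : ℝ)) ^ (d + 1) ≠ 0 := pow_ne_zero _ hL0.ne'
  field_simp
  ring

/-- ★★ **THE LEVEL FACTOR IS ABSORBED BY (2.60) UNDER AN M-THRESHOLD**: for `ε > 0` and every index with `(d+3)·log L ≤ ε·(2L²−1)·M`,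
`Λ_y⁻¹Λ_{y′}⁻¹(Lʲη)(y)²L^{−j(y′)D} ≤ L^{(d+3)∕2}·e^{(ε∕2)d(y,y′)}` (Lemma 2.1: `L^{|j−j′|}` against `e^{εd}` when `RM` is large).
[cite: Balaban1984PropagatorsII, Lemma 2.1 (2.60) p.234, (2.149) p.249; Balaban1985BackgroundPropagators, (3.132) p.422] -/
theorem levelFactor_le {ε : ℝ} (hε : 0 < ε) (hM : ((d : ℝ) + 3) * Real.log (geo9K i).L ≤ ε * (2 * ((ℓ : ℝ) + 1) ^ 2 - 1) * (geo9K i).M)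
    (y y' : IBondY i) :
    lamInvY i y * lamInvY i y' * (geo9K i).len y ^ 2 * ((((ℓ + 1 : ℕ) : ℝ) ^ (d + 1)) ^ (lvl i.hN i.D i.hk y'))⁻¹ ≤
      (geo9K i).L ^ (((d : ℝ) + 3) / 2) * Real.exp (ε / 2 * (geo9K i).dist y y') := by
  set P := lamInvY i y * lamInvY i y' * (geo9K i).len y ^ 2 * ((((ℓ + 1 : ℕ) : ℝ) ^ (d + 1)) ^ (lvl i.hN i.D i.hk y'))⁻¹ with hP
  have hP0 : 0 ≤ P := by
    rw [hP]
    have := lamInvY_pos i y; have := lamInvY_pos i y'; have := geo9K_len_pos i y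
    positivity
  have hl' := geo9K_len_pos i y'
  have hL1 := geo9K_one_le_L i
  have hL0 : 0 < (geo9K i).L := lt_of_lt_of_le one_pos hL1
  -- (2.60): `len y ^ (d+3) ≤ L^{d+3} e^{ε d(y′,y)} len y′ ^ (d+3)`
  have hq : |((d : ℝ) + 3)| * Real.log (geo9K i).L ≤ ε * (2 * ((ℓ : ℝ) + 1) ^ 2 - 1) * (geo9K i).M := by
    rwa [abs_of_nonneg (by positivity : (0 : ℝ) ≤ (d : ℝ) + 3)]
  have ht := transferL_geo9K i hε ((d : ℝ) + 3) hq y' y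
  rw [abs_of_nonneg (by positivity : (0 : ℝ) ≤ (d : ℝ) + 3), geo9K_dist_comm i y' y] at ht
  have hnat : ((d : ℝ) + 3) = ((d + 3 : ℕ) : ℝ) := by push_cast; ring
  rw [hnat, Real.rpow_natCast, Real.rpow_natCast, Real.rpow_natCast] at ht
  -- `P² · len y′^{d+3} = len y^{d+3} ≤ L^{d+3} e^{εd} len y′^{d+3}`, cancel `len y′^{d+3} > 0`
  have hsq : P ^ 2 ≤ (geo9K i).L ^ (d + 3) * Real.exp (ε * (geo9K i).dist y y') := by
    have hid := levelFactor_sq i y y'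
    rw [← hP] at hid
    have hpos : 0 < (geo9K i).len y' ^ (d + 3) := pow_pos hl' _
    have : P ^ 2 * (geo9K i).len y' ^ (d + 3) ≤ ((geo9K i).L ^ (d + 3) * Real.exp (ε * (geo9K i).dist y y')) * (geo9K i).len y' ^ (d + 3) := by
      rw [hid]; exact ht
    exact le_of_mul_le_mul_right this hpos
  -- take square roots
  set Q := (geo9K i).L ^ (((d : ℝ) + 3) / 2) * Real.exp (ε / 2 * (geo9K i).dist y y') with hQ
  have hQ0 : 0 ≤ Q := by rw [hQ]; positivity
  have hQsq : Q ^ 2 = (geo9K i).L ^ (d + 3) * Real.exp (ε * (geo9K i).dist y y') := by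
    rw [hQ, mul_pow, ← Real.rpow_natCast ((geo9K i).L ^ (((d : ℝ) + 3) / 2)) 2, ← Real.rpow_mul hL0.le, sq, ← Real.exp_add]
    push_cast
    rw [show ((d : ℝ) + 3) / 2 * 2 = ((d + 3 : ℕ) : ℝ) by push_cast; ring, Real.rpow_natCast]
    congr 1; ring_nf
  have := hsq.trans (le_of_eq hQsq.symm)
  exact (pow_le_pow_iff_left₀ hP0 hQ0 two_ne_zero).1 this

end Powers

end Literature.MathematicalPhysics.QuantumFieldTheory.Balaban1983to89.B9Eq3132Ineq2142Covariant

end
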